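import Summits.BirchSwinnertonDyer.Rank1Residual.X11b.ClassClosureWeightKChainLever
import Summits.BirchSwinnertonDyer.Rank1Residual.Iwasawa.UnitCoefficientFromRiemannSum
import HarnessLib

/-!
# Class X11b = N8 at `p ≥ 5` (lane CLASS-CLOSURE, seat `cc-typer-3`): ONE STATEMENT OF RECORD on
# the surjective-image cells — the (ram) road (Skinner) and the `μ^an = 0` road (weight-`k` chain)
# through the SAME lever, per-pair inputs = finite certificates (cell `b2b-bsdres`)

HONEST FRAMING (verbatim, cell `b2b-bsdres`, run/shared/lean/b2b/bsd-rank1-residual/): the goal of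
the cell is to DELETE the COMBINATION-SHAPED residual classes for ALL analytic-rank `≤ 1` curves
over `ℚ` — "full BSD formula for every rank `≤ 1` curve in class `C`" assembled STRICTLY from
published theorems — so that the rank-`≤ 1` remainder becomes exactly the CONSTRUCTION-SHAPED
classes, which are TYPED (missing-input Props), NOT attempted; this is not "finishing BSD".
Lane CLASS-CLOSURE (coordinator ruling 2026-08-21T04:07Z): prove what is provable now; shrink each
hard class to its core with data; no claim beyond stated classes. THEOREMS ONLY (no definition, no
named fact, no `sorry`); nothing booked; no label / RESIDUAL-MAP mark changes; X11b stays
CONSTRUCTION-SHAPED; every theorem is CONDITIONAL on the named published facts and per-pair inputs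
it lists; census / instrument rows (a unit coefficient or a certified Riemann sum of `ϖ·L_p`, a
REGMULT height, the bit "second multiplicative prime") are EVIDENCE / instrumentation — their worth
is referee A's / the lane's ruling; the class-wide statements behind them (Greenberg's
`μ`-conjecture, Schneider's conjecture — barrier `PAdicHeightNondegeneracy`) are NEVER asserted.

## What this file does

N8 at `p ≥ 5` (rmap-3 g7 table: 3 861 cells = atoms A1 ∪ A2 (ram) 3 723 + A3 `¬Ram ∧ surj` 137 +
A4 `¬Ram ∧ ¬surj` 1) had two kernel roads through this seat's lever: on (ram) cells Skinner 2016
Thm. A (`ClassClosure.bsdp_of_leverLocus_of_regulatorNonvanishing`, p249673 — no `μ`), and on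
`¬Ram ∧ surj` cells the weight-`k` chain of T-WK (`bsdp_of_namedFacts_bdd_of_regulatorNonvanishing`,
p274916 — certificate `μ^an(E,p) = 0`). Since `Ram ⇒ Surj` on irreducible `E[p]`
(`surj_of_irr_of_ram`) and a (ram) prime IS a second multiplicative prime, the two roads have ONE
statement: §1 `bsdp_of_classX11b_five_le_of_ram_or_muAnZeroAt` — for `ClassX11b W p`, `5 ≤ p`,
`Ram W p ∨ (Surj W p ∧ MuAnZeroAt W p)`, the per-pair `RegulatorNonvanishingAt W p`, and AT A SPLIT
`p` WITHOUT (ram) either a second multiplicative prime (Disegni's (∗)) or the lane's conjecture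
`RelativeExceptionalLeadingTermAt W p`: `BSD(E,p)` from named published facts only; the REGMULT-row
twin `…_of_cert`; §2 the `μ`-road fed by a certified Riemann sum (iw-1's `Iwasawa.RiemannSumUnitCertAt`,
the currency of cc-typer-6's certificate theorems p267689 / p269270, via
`Iwasawa.muAnZeroAt_of_riemannSumUnitCertAt`) — `bsdp_of_riemannSumUnitCert_of_cert`; §3 the ∀-form.
READING (EVIDENCE; no count moved; nothing booked): N8 @ `p ≥ 5` minus the one `¬Surj` cell
(84960d1@5, image `5Ns`: the C6-CM-PARTNER road of p254516) is, modulo the named facts, CERTIFICATE-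
SHAPED per pair — REGMULT everywhere (tranche 0: 138/138 CERT on `¬Ram`; production 5 407 rows =
the (ram) cells, census-ctyper-2 folds), `μ^an = 0` on the `¬Ram ∧ surj` cells (cc-lead RULING (8)(a):
decided 138/138), and on the ONE split `¬Ram` cell with `p` the only multiplicative prime
(485100hk1@11) the conjecture. Tier / label = referee A + x11b3 lead.

References: [Skinner2016PacificMC] Thm. A; [EmertonPollackWeston2006] Thm. 1, 3.1.1, 5.1.3;
[Wan2015] Thm. 4; [Wuthrich2014] Thm. 3, Cor. 19; [SteinWuthrich2013] Thm. 6.1, §4.2; [Disegni2020]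
Thm. 1, (∗); [MazurTateTeitelbaum1986Invent] §I.10, §I.14; [Miller2011LMS] Def. 1.1;
HOME/class-closure/O2/TYPER-3.md §9 (GEN 3).
-/

set_option autoImplicit false

noncomputable section

open scoped Classical MatrixGroups ModularForm

open CongruenceSubgroup WeierstrassCurve Literature.NumberTheory.EllipticCurves
  Literature.NumberTheory.EllipticCurves.ModularForms
  Literature.NumberTheory.EllipticCurves.Rank1Residual
  Literature.NumberTheory.EllipticCurves.Rank1Residual.Typed
  Literature.NumberTheory.EllipticCurves.Skinner2016
  Literature.NumberTheory.EllipticCurves.SteinWuthrich2013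
  Literature.NumberTheory.EllipticCurves.Wuthrich2014
  Literature.NumberTheory.EllipticCurves.Disegni2020
  Literature.NumberTheory.EllipticCurves.GreenbergVatsal2000
  Literature.NumberTheory.EllipticCurves.EmertonPollackWeston2006
  Summit.BirchSwinnertonDyer.Rank1Residual.X1.MuLambda

namespace Summit.BirchSwinnertonDyer.Rank1Residual.X11b.ClassClosure

open X11a X11a.Chain

/-! ### §1 N8 at `p ≥ 5`: the two roads as one statement -/

section Statement

variable (W : WeierstrassCurve ℚ) [W.IsElliptic] [W.IsGloballyMinimal] (p : ℕ) [Fact p.Prime]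

/-- **N8 AT `p ≥ 5`, STATEMENT OF RECORD (this seat's lever, both roads).** For an X11b pair
(`ord_{s=1} L(E,s) = 1`, `p ‖ N`, `E[p]` irreducible) with `p ≥ 5`: `BSD(E,p)` from NAMED PUBLISHED
FACTS ONLY — Skinner 2016 Thm. A (`hA`, used on the (ram) road), x11a's weight-`k` chain facts (Hida
member, MTT weight `k`, EPW 3.1.1 / Thm 1 / 5.1.3 bounded, Wan Thm 4 rational bounded, Deligne–Serre
6.1, Hida 3.26, Kato–Wuthrich A32; used on the `μ`-road), Stein–Wuthrich Thm 6.1 ×2 + §4.2 ×2,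
Disegni 2020 Thm 1, GZK, modularity — given (α) `Ram W p` OR (`Surj W p` AND the certificate
`MuAnZeroAt W p`), (β) the per-pair `RegulatorNonvanishingAt W p`, and (γ) IF `E` is split at `p`
and NOT (ram): a second multiplicative prime (Disegni's (∗)) OR the lane's EVIDENCE-labelled
conjecture `RelativeExceptionalLeadingTermAt W p`. (On (ram) cells the (ram) prime is the second
multiplicative prime and `μ` is not needed; `Ram ⇒ Surj`.) NO analytic-rank-zero, NO `#Ш_an` /
Tamagawa / anomalous / partner hypothesis. CONDITIONAL (on an unproved conjecture only where (γ)'s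
second disjunct is used); nothing booked; X11b stays CONSTRUCTION-SHAPED.
[cite: Skinner2016PacificMC, Thm. A] [cite: EmertonPollackWeston2006, Thm. 1, Thm. 3.1.1, Thm. 5.1.3]
[cite: Wan2015, Thm. 4] [cite: Wuthrich2014, Thm. 3 (p. 382) and Cor. 19 proof (p. 399)]
[cite: SteinWuthrich2013, Thm. 6.1 (p. 20), §4.2] [cite: Disegni2020, Thm. 1 (§1.2), hypothesis (∗)]
[cite: Miller2011LMS, Def. 1.1] -/
theorem bsdp_of_classX11b_five_le_of_ram_or_muAnZeroAt (hA : thmA_charIdeal_multiplicative)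
    (hHida : hida_exists_congruent_ordinary_newform_of_multiplicative)
    (hMTT : exists_isCycPAdicLFunctionWeightK)
    (h311 : thm311_cotorsion_weightK_member) (hT1a : thm1_muAlg_of_weightK_member)
    (hT2 : Wan2015.thm4_rational_weightK_member_of_bdd)
    (hT1b : thm513_transfer_from_weightK_member_of_bdd)
    (h61 : DeligneSerre1974.thm61_exists_adicGaloisRep) (h326 : Hida2000_thm326_ordinary)
    (hKato : kato_charIdeal_dvd_multiplicative_of_surjective)
    (hJn : thm61_nonsplitMultiplicative) (hJs : thm61_splitMultiplicative)
    (hHn : exists_isMultCanonical) (hHs : exists_isSplitMultCanonical)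
    (hD : thm1_padicBSD_rankOne_multiplicative)
    (hGZK : rank_eq_analyticRank_of_analyticRank_le_one) (hpar : nonempty_modularParametrizationData)
    (hX : ClassX11b W p) (hp : 5 ≤ p) (hroad : Ram W p ∨ (Surj W p ∧ MuAnZeroAt W p))
    (hReg : RegulatorNonvanishingAt W p)
    (hγ : W.HasSplitMultiplicativeReductionAtPrime p → ¬ Ram W p →
      (∃ (m : ℕ) (_ : Fact m.Prime), m ≠ p ∧ W.HasMultiplicativeReductionAtPrime m) ∨
        RelativeExceptionalLeadingTermAt W p) :
    BSDp W p := by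
  rcases hroad with hram | ⟨hsurj, hμ⟩
  · -- the (ram) road: Skinner Thm. A feeds the lever; at a split `p` the (ram) prime is Disegni's (∗)
    exact bsdp_of_leverLocus_of_regulatorNonvanishing W p hA hJn hJs hHn hHs hD hGZK hpar hX
      (leverLocusAt_of_ram_of_five_le W p hram hp) hReg
  · by_cases hram : Ram W p
    · exact bsdp_of_leverLocus_of_regulatorNonvanishing W p hA hJn hJs hHn hHs hD hGZK hpar hX
        (leverLocusAt_of_ram_of_five_le W p hram hp) hReg
    · -- the `μ`-road: the weight-`k` chain feeds the lever; (γ) at a split `p`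
      by_cases hsplit : W.HasSplitMultiplicativeReductionAtPrime p
      · rcases hγ hsplit hram with hm | hC
        · exact bsdp_of_namedFacts_bdd_of_regulatorNonvanishing W p hHida hMTT h311 hT1a hT2 hT1b h61
            h326 hKato hJn hJs hHn hHs hD hGZK hpar hX hp hsurj hμ (fun _ => hm) hReg
        · exact bsdp_of_namedFacts_bdd_of_regulatorNonvanishing_of_conjecture W p hHida hMTT h311 hT1a
            hT2 hT1b h61 h326 hKato hJn hJs hHn hHs hD hGZK hpar hX hp hsurj hμ hReg (fun _ => hC)
      · exact bsdp_of_namedFacts_bdd_of_regulatorNonvanishing W p hHida hMTT h311 hT1a hT2 hT1b h61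
          h326 hKato hJn hJs hHn hHs hD hGZK hpar hX hp hsurj hμ (fun hs => absurd hs hsplit) hReg

/-- **The same with ONE REGMULT row of the reduction sign's kind in place of the bundled regulator
input** (`RegMult.CertNonsplit` iff non-split / `RegMult.CertSplit` iff split; on the (ram) road via
census-ctyper-2's `RegMult.bsdp_of_leverLocus_of_cert`, on the `μ`-road via
`bsdp_of_namedFacts_bdd_of_cert`, and in the conjecture case via the split Schneider half
`RegMult.schneiderHalf_split_of_cert`). CONDITIONAL; nothing booked; rows are instrumentation.
[cite: Skinner2016PacificMC, Thm. A] [cite: EmertonPollackWeston2006, Thm. 1, Thm. 3.1.1, Thm. 5.1.3]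
[cite: Wan2015, Thm. 4] [cite: SteinWuthrich2013, Thm. 6.1, §4.2] [cite: Disegni2020, Thm. 1 (§1.2), hypothesis (∗)]
[cite: Miller2011LMS, Def. 1.1] [cite: Schneider1982PadicHeightI, §1] -/
theorem bsdp_of_classX11b_five_le_of_ram_or_muAnZeroAt_of_cert (hA : thmA_charIdeal_multiplicative)
    (hHida : hida_exists_congruent_ordinary_newform_of_multiplicative)
    (hMTT : exists_isCycPAdicLFunctionWeightK)
    (h311 : thm311_cotorsion_weightK_member) (hT1a : thm1_muAlg_of_weightK_member)
    (hT2 : Wan2015.thm4_rational_weightK_member_of_bdd)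
    (hT1b : thm513_transfer_from_weightK_member_of_bdd)
    (h61 : DeligneSerre1974.thm61_exists_adicGaloisRep) (h326 : Hida2000_thm326_ordinary)
    (hKato : kato_charIdeal_dvd_multiplicative_of_surjective)
    (hJn : thm61_nonsplitMultiplicative) (hJs : thm61_splitMultiplicative)
    (hHn : exists_isMultCanonical) (hHs : exists_isSplitMultCanonical)
    (hD : thm1_padicBSD_rankOne_multiplicative)
    (hGZK : rank_eq_analyticRank_of_analyticRank_le_one) (hpar : nonempty_modularParametrizationData)
    (hX : ClassX11b W p) (hp : 5 ≤ p) (hroad : Ram W p ∨ (Surj W p ∧ MuAnZeroAt W p))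
    {P : W.toAffine.Point} {m : ℕ}
    (hcn : ¬ W.HasSplitMultiplicativeReductionAtPrime p → RegMult.CertNonsplit W p P m)
    (hcs : W.HasSplitMultiplicativeReductionAtPrime p → RegMult.CertSplit W p P m)
    (hγ : W.HasSplitMultiplicativeReductionAtPrime p → ¬ Ram W p →
      (∃ (m : ℕ) (_ : Fact m.Prime), m ≠ p ∧ W.HasMultiplicativeReductionAtPrime m) ∨
        RelativeExceptionalLeadingTermAt W p) :
    BSDp W p := by
  rcases hroad with hram | ⟨hsurj, hμ⟩
  · exact RegMult.bsdp_of_leverLocus_of_cert W p hA hJn hJs hHn hHs hD hGZK hpar hX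
      (leverLocusAt_of_ram_of_five_le W p hram hp) hcn hcs
  · by_cases hram : Ram W p
    · exact RegMult.bsdp_of_leverLocus_of_cert W p hA hJn hJs hHn hHs hD hGZK hpar hX
        (leverLocusAt_of_ram_of_five_le W p hram hp) hcn hcs
    · by_cases hsplit : W.HasSplitMultiplicativeReductionAtPrime p
      · rcases hγ hsplit hram with hm | hC
        · exact bsdp_of_namedFacts_bdd_of_cert W p hHida hMTT h311 hT1a hT2 hT1b h61 h326 hKato hJn hJs
            hHn hHs hD hGZK hpar hX hp hsurj hμ (fun _ => hm) hcn hcs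
        · exact bsdp_of_mazurMainConjectureAt_of_split_of_conjecture_of_schneider W p hJs hHs hGZK hpar
            hX hsplit
            (mazurMainConjectureAt_of_namedFacts_bdd W p hHida hMTT h311 hT1a hT2 hT1b h61 h326 hKato
              hpar hp hX.2.2.1 hsurj hμ)
            hC (RegMult.schneiderHalf_split_of_cert
              (mordellWeilRank_eq_one_of_analyticRank hGZK hX.1) (hcs hsplit))
      · exact bsdp_of_namedFacts_bdd_of_cert W p hHida hMTT h311 hT1a hT2 hT1b h61 h326 hKato hJn hJs
          hHn hHs hD hGZK hpar hX hp hsurj hμ (fun hs => absurd hs hsplit) hcn hcs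

end Statement

/-! ### §2 The `μ`-road fed by a certified Riemann sum -/

section RiemannSum

variable (W : WeierstrassCurve ℚ) [W.IsElliptic] [W.IsGloballyMinimal] (p : ℕ) [Fact p.Prime]

/-- **TWO FINITE CERTIFICATES PER PAIR, Riemann-sum currency**: on X11b at `p ≥ 5` with
`ρ̄_{E,p}` onto, `BSD(E,p)` from the named published facts + ONE certified Riemann sum of the
plus-symbol measure witnessing a unit coefficient of `ϖ·L_p` (iw-1's `Iwasawa.RiemannSumUnitCertAt
W p n`, the datum of a census certificate at a multiplicative prime in the currency of cc-typer-6's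
`PAdicLFunction[Split]RiemannSumCertificateProofs`; ⇒ `UnitCoeffAt` ⇒ `MuAnZeroAt` by
`Iwasawa.muAnZeroAt_of_riemannSumUnitCertAt`) + ONE REGMULT row of the sign's kind (+ at a split `p`
a second multiplicative prime). CONDITIONAL; nothing booked; rows are instrumentation.
[cite: MazurTateTeitelbaum1986Invent, §I.10 Prop. and §I.14] [cite: EmertonPollackWeston2006, Thm. 1, Thm. 5.1.3]
[cite: Wan2015, Thm. 4] [cite: SteinWuthrich2013, Thm. 6.1, §4.2] [cite: Disegni2020, Thm. 1 (§1.2), hypothesis (∗)]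
[cite: Miller2011LMS, Def. 1.1] -/
theorem bsdp_of_riemannSumUnitCert_of_cert
    (hHida : hida_exists_congruent_ordinary_newform_of_multiplicative)
    (hMTT : exists_isCycPAdicLFunctionWeightK)
    (h311 : thm311_cotorsion_weightK_member) (hT1a : thm1_muAlg_of_weightK_member)
    (hT2 : Wan2015.thm4_rational_weightK_member_of_bdd)
    (hT1b : thm513_transfer_from_weightK_member_of_bdd)
    (h61 : DeligneSerre1974.thm61_exists_adicGaloisRep) (h326 : Hida2000_thm326_ordinary)
    (hKato : kato_charIdeal_dvd_multiplicative_of_surjective)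
    (hJn : thm61_nonsplitMultiplicative) (hJs : thm61_splitMultiplicative)
    (hHn : exists_isMultCanonical) (hHs : exists_isSplitMultCanonical)
    (hD : thm1_padicBSD_rankOne_multiplicative)
    (hGZK : rank_eq_analyticRank_of_analyticRank_le_one) (hpar : nonempty_modularParametrizationData)
    (hX : ClassX11b W p) (hp : 5 ≤ p) (hsurj : Surj W p) {n : ℕ}
    (hRS : Iwasawa.RiemannSumUnitCertAt W p n)
    (hm : W.HasSplitMultiplicativeReductionAtPrime p →
      ∃ (m : ℕ) (_ : Fact m.Prime), m ≠ p ∧ W.HasMultiplicativeReductionAtPrime m)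
    {P : W.toAffine.Point} {m : ℕ}
    (hcn : ¬ W.HasSplitMultiplicativeReductionAtPrime p → RegMult.CertNonsplit W p P m)
    (hcs : W.HasSplitMultiplicativeReductionAtPrime p → RegMult.CertSplit W p P m) : BSDp W p :=
  bsdp_of_namedFacts_bdd_of_cert W p hHida hMTT h311 hT1a hT2 hT1b h61 h326 hKato hJn hJs hHn hHs hD
    hGZK hpar hX hp hsurj (Iwasawa.muAnZeroAt_of_riemannSumUnitCertAt hX.2.2.1 hRS) hm hcn hcs

end RiemannSum

/-! ### §3 Class level -/

/-- **N8 ∩ {`p ≥ 5`}: the ∀-form of `bsdp_of_classX11b_five_le_of_ram_or_muAnZeroAt`** — on every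
X11b pair at `p ≥ 5` carrying (ram) or (surjective image + `μ^an(E,p) = 0`), `BSD(E,p)` follows from
the named published facts, the per-pair regulator input and, at a split `p` off (ram), Disegni's (∗)
or the lane's conjecture. What is NOT covered at `p ≥ 5`: the `¬Ram ∧ ¬Surj` corner (rmap-3 atom A4;
CM-partner road p254516). No label change (referee A / x11b3 lead); CONDITIONAL; nothing booked;
X11b stays CONSTRUCTION-SHAPED. [cite: Skinner2016PacificMC, Thm. A]
[cite: EmertonPollackWeston2006, Thm. 1, Thm. 3.1.1, Thm. 5.1.3] [cite: Wan2015, Thm. 4]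
[cite: SteinWuthrich2013, Thm. 6.1 (p. 20), §4.2] [cite: Disegni2020, Thm. 1 (§1.2), hypothesis (∗)]
[cite: Miller2011LMS, Def. 1.1] -/
theorem forall_bsdp_five_le_of_ram_or_muAnZeroAt (hA : thmA_charIdeal_multiplicative)
    (hHida : hida_exists_congruent_ordinary_newform_of_multiplicative)
    (hMTT : exists_isCycPAdicLFunctionWeightK)
    (h311 : thm311_cotorsion_weightK_member) (hT1a : thm1_muAlg_of_weightK_member)
    (hT2 : Wan2015.thm4_rational_weightK_member_of_bdd)
    (hT1b : thm513_transfer_from_weightK_member_of_bdd)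
    (h61 : DeligneSerre1974.thm61_exists_adicGaloisRep) (h326 : Hida2000_thm326_ordinary)
    (hKato : kato_charIdeal_dvd_multiplicative_of_surjective)
    (hJn : thm61_nonsplitMultiplicative) (hJs : thm61_splitMultiplicative)
    (hHn : exists_isMultCanonical) (hHs : exists_isSplitMultCanonical)
    (hD : thm1_padicBSD_rankOne_multiplicative)
    (hGZK : rank_eq_analyticRank_of_analyticRank_le_one) (hpar : nonempty_modularParametrizationData) :
    ∀ (W : WeierstrassCurve ℚ) [W.IsElliptic] [W.IsGloballyMinimal] (p : ℕ) [Fact p.Prime],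
      ClassX11b W p → 5 ≤ p → (Ram W p ∨ (Surj W p ∧ MuAnZeroAt W p)) →
      RegulatorNonvanishingAt W p →
      (W.HasSplitMultiplicativeReductionAtPrime p → ¬ Ram W p →
        (∃ (m : ℕ) (_ : Fact m.Prime), m ≠ p ∧ W.HasMultiplicativeReductionAtPrime m) ∨
          RelativeExceptionalLeadingTermAt W p) → BSDp W p :=
  fun W _ _ p _ hX hp hroad hReg hγ =>
    bsdp_of_classX11b_five_le_of_ram_or_muAnZeroAt W p hA hHida hMTT h311 hT1a hT2 hT1b h61 h326 hKato
      hJn hJs hHn hHs hD hGZK hpar hX hp hroad hReg hγ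

end Summit.BirchSwinnertonDyer.Rank1Residual.X11b.ClassClosure

end
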